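import Mathlib
import HarnessLib
import Summits.NavierStokesRegularity.NavierStokesRegularity.Theorems.HalfSpaceWindowDoorCirculationCarryingRigidityConeLiouville
import Summits.NavierStokesRegularity.NavierStokesRegularity.Theorems.HalfSpaceWindowDoorCirculationCarryingRigidityTransportRigidity
import Summits.NavierStokesRegularity.NavierStokesRegularity.Theorems.AxisTwistDoorAveragedConeLiouvilleCircleLimits

/-!
# Route `HalfSpaceWindowDoor`, crux `CirculationCarryingRigidity` (stmt-NavierStokesRegularity-25311) —
# line `cone_sweep`, the KINEMATIC CORE: parabolic confinement of the circulation already forces poloidality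

LEAD ns-hsw-p1 g9, `--supports stmt-NavierStokesRegularity-25311 --as helper`; card `Cruxes/…/Lines/cone_sweep.md`.  In `…RecordLiouville` (p688291)
the dynamics (the transport bound, via the sweeping lemma) is used for ONE purpose only: to show that in a far-past epoch the circulations
`Γ(r,z,s) = ∮_{S(r,z)} v·dl` of ALL discs about the axis are dominated by (the supremum `S₀ < ∞` of) the circulations of the PARABOLIC-TUBE-BOUNDARY
discs `D(R₁√(−s), z)`.  This file isolates the remaining, purely kinematic + analytic step:

**Theorem (`inner_curl_e3_eq_zero_of_confined`).**  Let `v` be a closed-hemisphere door-class profile (any `C`), `R₁ ≥ 0`, `σ₀ < 0`, `S₀ ∈ ℝ` with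
(a) `Γ(r,z,s) ≤ S₀` for all `s ≤ σ₀`, `r ≥ 0`, `z` and (b) `S₀` is approached by tube-boundary discs: for every `ε > 0` some `Γ(R₁√(−s), z, s) > S₀ − ε`
with `s ≤ σ₀`.  Then `v` is POLOIDAL (`⟪curl v, e₃⟫ ≡ 0`).  Proof: `S₀ ≤ 0` ⇒ `Γ ≤ 0` in the epoch ⇒ poloidal there
(`inner_curl_e3_eq_zero_of_circ_nonpos`) ⇒ everywhere (`inner_curl_e3_eq_zero_of_far_past`); `S₀ > 0` ⇒ zoom about `(0,0,z_n)` by `√(−s_n)`, F3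
limit `W` (door class, closed hemisphere) with `Γ_W(R₁,0,−1) = S₀ ≥ Γ_W(r,0,−1)` ⇒ PLANE RIGIDITY (`circ_eq_zero_of_saturated_plane`) ⇒ `S₀ = 0`.
CENSUS READING (`enemy_unconfined`): for a circulation-carrying closed-hemisphere door-class profile, in every far-past epoch and for every `R₁`,
the tube-boundary discs `D(R₁√(−s), z)` stay a DEFINITE amount below every bound of the epoch's circulations — a definite part of the (possibly
infinite) supremal circulation always lies OUTSIDE every parabolic tube about every axis.  By-name reduction: `hemisphereLiouvilleE3_of_confinement`.
WHAT THIS IS NOT: not about NS regularity; HYPOTHETICAL profiles; `HemisphereLiouvilleE3` itself stays OPEN.  No item is closed by this file.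
-/

noncomputable section

-- the summit and its single sub-problem share the name (CONVENTIONS §1), as in every Theorems file
set_option linter.dupNamespace false

namespace Summit.NavierStokesRegularity.NavierStokesRegularity.Theorems.HalfSpaceWindowDoorCirculationCarryingRigidityParabolicConfinement

open MeasureTheory Set Function Filter Topology InnerProductSpace
open scoped RealInnerProductSpace InnerProductSpace
open Literature.Analysis Literature.Analysis.UnboundedOperators
open Literature.Analysis.FluidPDE hiding eR
open Summit.NavierStokesRegularity.NavierStokesRegularity.Theses.HalfSpaceWindowDoor
open Summit.NavierStokesRegularity.NavierStokesRegularity.Theorems.HalfSpaceWindowDoorCirculationCarryingRigidityDefs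
  (InDoorClass SignE3 e3 HemisphereLiouvilleE3)
open Summit.NavierStokesRegularity.NavierStokesRegularity.Theorems.AxisTwistDoorAveragedConeLiouvilleDefs (cylPt circ)
open Summit.NavierStokesRegularity.NavierStokesRegularity.Theorems.AveragedConeLiouville.CircleLimits (tendsto_circ)
open Summit.NavierStokesRegularity.NavierStokesRegularity.Theorems
  (exists_tendsto_of_isTypeIAncientMild_seq isTypeIAncientMild_zoom zoom_apply)
open Summit.NavierStokesRegularity.NavierStokesRegularity.Theorems.HalfSpaceWindowDoorCirculationCarryingRigidityGaussExtremal
  (inDoorClass_of_isTypeIAncientMild)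
open Summit.NavierStokesRegularity.NavierStokesRegularity.Theorems.HalfSpaceWindowDoorCirculationCarryingRigidityHorizontalVorticityFloor
  (tendsto_curl_of_tendsto_fderiv)
open Summit.NavierStokesRegularity.NavierStokesRegularity.Theorems.PoloidalWindowDoorPoloidalWindowRigidityWindow
  (isTypeIAncientMild_of_class)
open Summit.NavierStokesRegularity.NavierStokesRegularity.Theorems.HalfSpaceWindowDoorCirculationCarryingRigidityCriticalStretchingAnalytic
  (inner_curl_e3_eq_zero_of_far_past)
open Summit.NavierStokesRegularity.NavierStokesRegularity.Theorems.HalfSpaceWindowDoorCirculationCarryingRigidityTransportRigidity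
  (circ_eq_zero_of_saturated_plane inner_curl_e3_eq_zero_of_circ_nonpos)
open Summit.NavierStokesRegularity.NavierStokesRegularity.Theorems.HalfSpaceWindowDoorCirculationCarryingRigidityConeLiouville
  (axisPt_add_smul_cylPt circ_zoom_axis)

variable {C : ℝ} {v : ℝ → EuclideanSpace ℝ (Fin 3) → EuclideanSpace ℝ (Fin 3)}

/-- **PARABOLIC CONFINEMENT ⇒ POLOIDAL.**  If in a far-past epoch `s ≤ σ₀` all disc circulations about the axis are bounded by `S₀` and `S₀` is
approached by the tube-boundary discs `D(R₁√(−s), z)` of the epoch, the closed-hemisphere door-class profile is poloidal. -/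
theorem inner_curl_e3_eq_zero_of_confined (hv : InDoorClass C v) (hsign : SignE3 v) {R₁ : ℝ} (hR₁ : 0 ≤ R₁) {σ₀ : ℝ} (hσ₀ : σ₀ < 0)
    {S₀ : ℝ} (hle : ∀ s : ℝ, s ≤ σ₀ → ∀ r : ℝ, 0 ≤ r → ∀ z : ℝ, circ v r z s ≤ S₀)
    (hnear : ∀ ε : ℝ, 0 < ε → ∃ s : ℝ, s ≤ σ₀ ∧ ∃ z : ℝ, S₀ - ε < circ v (R₁ * Real.sqrt (-s)) z s) :
    ∀ s < 0, ∀ y, ⟪curl (v s) y, e3⟫ = 0 := by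
  have hA : IsTypeIAncientMild C v := isTypeIAncientMild_of_class hv.1 hv.2.1 hv.2.2.1 hv.2.2.2
  have hm1 : (-1 : ℝ) < 0 := by norm_num
  rcases le_or_gt S₀ 0 with hS | hS
  · -- the far past is poloidal, hence the whole slab
    have hpast : ∀ τ < σ₀, ∀ y, ⟪curl (v τ) y, e3⟫ = 0 := fun τ hτ =>
      inner_curl_e3_eq_zero_of_circ_nonpos hv hsign (hτ.trans hσ₀) fun r hr z => (hle τ hτ.le r hr z).trans hS
    exact inner_curl_e3_eq_zero_of_far_past hv.1 hv.2.1 hv.2.2.1 hσ₀ hpast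
  -- `S₀ > 0`: near-maximal tube-boundary discs, zooms, F3 limit, plane rigidity
  exfalso
  have hnear' : ∀ n : ℕ, ∃ p : ℝ × ℝ, p.1 ≤ σ₀ ∧ S₀ - 1 / ((n : ℝ) + 1) < circ v (R₁ * Real.sqrt (-p.1)) p.2 p.1 := by
    intro n
    obtain ⟨s, hs, z, h⟩ := hnear (1 / ((n : ℝ) + 1)) (by positivity)
    exact ⟨(s, z), hs, h⟩
  choose p hp1 hp2 using hnear'
  set sn : ℕ → ℝ := fun n => (p n).1 with hsn
  set zn : ℕ → ℝ := fun n => (p n).2 with hzn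
  have hsn0 : ∀ n, sn n < 0 := fun n => lt_of_le_of_lt (hp1 n) hσ₀
  set lam : ℕ → ℝ := fun n => Real.sqrt (-sn n) with hlam
  have hlam0 : ∀ n, 0 < lam n := fun n => Real.sqrt_pos.2 (neg_pos.2 (hsn0 n))
  have hlam2 : ∀ n, lam n ^ 2 = -sn n := fun n => Real.sq_sqrt (neg_pos.2 (hsn0 n)).le
  set w : ℕ → ℝ → EuclideanSpace ℝ (Fin 3) → EuclideanSpace ℝ (Fin 3) :=
    fun n => lam n • stPull (lam n ^ 2) (lam n) 0 (cylPt 0 0 (zn n)) v with hw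
  have hwcl : ∀ n, IsTypeIAncientMild C (w n) := fun n => isTypeIAncientMild_zoom hA (hlam0 n) _
  have hwcirc : ∀ n r z s, circ (w n) r z s = circ v (lam n * r) (zn n + lam n * z) (lam n ^ 2 * s) := fun n r z s =>
    circ_zoom_axis (lam n) (zn n) v r z s
  have hwR₁ : ∀ n, circ (w n) R₁ 0 (-1) = circ v (R₁ * Real.sqrt (-sn n)) (zn n) (sn n) := by
    intro n
    rw [hwcirc, mul_zero, add_zero, hlam2, mul_comm (lam n) R₁]
    congr 1
    ring
  have hwle1 : ∀ n, ∀ r : ℝ, 0 ≤ r → ∀ z, circ (w n) r z (-1) ≤ S₀ := by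
    intro n r hr z
    rw [hwcirc, show lam n ^ 2 * (-1 : ℝ) = sn n by rw [hlam2]; ring]
    exact hle _ (hp1 n) _ (mul_nonneg (hlam0 n).le hr) _
  have hwsign : ∀ n, SignE3 (w n) := by
    intro n σ hσ y
    have hcurl : curl (w n σ) y =
        (lam n * lam n) • curl (v (0 + lam n ^ 2 * σ)) (cylPt 0 0 (zn n) + lam n • y) :=
      curl_smul_stPull (lam n) (lam n ^ 2) (lam n) 0 (cylPt 0 0 (zn n)) v σ y
    rw [hcurl, real_inner_smul_left]
    refine mul_nonneg (mul_self_nonneg _) (hsign _ ?_ _)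
    rw [zero_add]; exact mul_neg_of_pos_of_neg (pow_pos (hlam0 n) 2) hσ
  obtain ⟨φ, hφ, W, hW, hpt, hptG, hlu, hluG⟩ := exists_tendsto_of_isTypeIAncientMild_seq C hwcl
  have hWdoor : InDoorClass C W := inDoorClass_of_isTypeIAncientMild hW
  have hWsign : SignE3 W := by
    intro σ hσ y
    have hc : Tendsto (fun j => ⟪curl (w (φ j) σ) y, e3⟫) atTop (𝓝 ⟪curl (W σ) y, e3⟫) :=
      (tendsto_curl_of_tendsto_fderiv (hptG σ hσ y)).inner tendsto_const_nhds
    exact ge_of_tendsto' hc fun j => hwsign (φ j) σ hσ y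
  have hclim : ∀ σ < 0, ∀ r z, Tendsto (fun j => circ (w (φ j)) r z σ) atTop (𝓝 (circ W r z σ)) := fun σ hσ r z =>
    tendsto_circ (fun j => (hwcl (φ j)).continuous_slice hσ) (hW.continuous_slice hσ) (hlu σ hσ) r z
  have hWR₁ : circ W R₁ 0 (-1) = S₀ := by
    refine tendsto_nhds_unique (hclim (-1) hm1 R₁ 0) ?_
    have hlow : Tendsto (fun j => S₀ - 1 / ((φ j : ℝ) + 1)) atTop (𝓝 S₀) := by
      have h1 : Tendsto (fun j => 1 / ((φ j : ℝ) + 1)) atTop (𝓝 0) := by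
        have hφ' : Tendsto (fun j => ((φ j : ℕ) : ℝ)) atTop atTop :=
          tendsto_natCast_atTop_atTop.comp hφ.tendsto_atTop
        have : Tendsto (fun j => ((φ j : ℝ) + 1)) atTop atTop := tendsto_atTop_add_const_right _ 1 hφ'
        exact tendsto_const_nhds.div_atTop this
      simpa using tendsto_const_nhds.sub h1
    refine tendsto_of_tendsto_of_tendsto_of_le_of_le hlow tendsto_const_nhds (fun j => ?_) fun j => ?_
    · rw [hwR₁]; exact (hp2 (φ j)).le
    · exact hwle1 (φ j) R₁ hR₁ 0
  have hWle : ∀ r : ℝ, 0 ≤ r → ∀ z, circ W r z (-1) ≤ S₀ := fun r hr z =>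
    le_of_tendsto' (hclim (-1) hm1 r z) fun j => hwle1 (φ j) r hr z
  have h0 := circ_eq_zero_of_saturated_plane hWdoor hWsign hm1 hR₁ hWR₁ (fun r hr => hWle r hr 0) R₁
  linarith

/-- **CENSUS READING (enemy form): circulation is never parabolically confined.**  For a circulation-carrying closed-hemisphere door-class profile,
every `R₁ ≥ 0`, every epoch `σ₀ < 0` and every bound `S₀` of the epoch's disc circulations, the tube-boundary discs `D(R₁√(−s), z)`, `s ≤ σ₀`,
stay a DEFINITE amount `ε > 0` below `S₀`. -/
theorem enemy_unconfined (hv : InDoorClass C v) (hsign : SignE3 v) (hpos : ∃ σ < 0, ∃ y, 0 < ⟪curl (v σ) y, e3⟫)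
    {R₁ : ℝ} (hR₁ : 0 ≤ R₁) {σ₀ : ℝ} (hσ₀ : σ₀ < 0) {S₀ : ℝ}
    (hle : ∀ s : ℝ, s ≤ σ₀ → ∀ r : ℝ, 0 ≤ r → ∀ z : ℝ, circ v r z s ≤ S₀) :
    ∃ ε : ℝ, 0 < ε ∧ ∀ s : ℝ, s ≤ σ₀ → ∀ z : ℝ, circ v (R₁ * Real.sqrt (-s)) z s ≤ S₀ - ε := by
  by_contra h
  push Not at h
  obtain ⟨σ, hσ, y, hy⟩ := hpos
  have h0 := inner_curl_e3_eq_zero_of_confined hv hsign hR₁ hσ₀ hle (fun ε hε => ?_) σ hσ y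
  · exact hy.ne' h0
  · obtain ⟨s, hs, z, hlt⟩ := h ε hε
    exact ⟨s, hs, z, hlt⟩

/-- **BY-NAME REDUCTION of the open stub to parabolic confinement.**  If every closed-hemisphere door-class profile has, about the `e₃`-axis, in
SOME far-past epoch, its disc circulations bounded by a constant approached by the tube-boundary discs of SOME parabolic tube, then
`HemisphereLiouvilleE3` holds. -/
theorem hemisphereLiouvilleE3_of_confinement
    (H : ∀ (C : ℝ) (v : ℝ → EuclideanSpace ℝ (Fin 3) → EuclideanSpace ℝ (Fin 3)), InDoorClass C v → SignE3 v →
      ∃ R₁ : ℝ, 0 ≤ R₁ ∧ ∃ σ₀ : ℝ, σ₀ < 0 ∧ ∃ S₀ : ℝ,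
        (∀ s : ℝ, s ≤ σ₀ → ∀ r : ℝ, 0 ≤ r → ∀ z : ℝ, circ v r z s ≤ S₀) ∧
        (∀ ε : ℝ, 0 < ε → ∃ s : ℝ, s ≤ σ₀ ∧ ∃ z : ℝ, S₀ - ε < circ v (R₁ * Real.sqrt (-s)) z s)) :
    HemisphereLiouvilleE3 := by
  intro C v hrate hcont hmild hdiv hnn
  have hv : InDoorClass C v := ⟨hrate, hcont, hmild, hdiv⟩
  obtain ⟨R₁, hR₁, σ₀, hσ₀, S₀, hle, hnear⟩ := H C v hv hnn
  exact inner_curl_e3_eq_zero_of_confined hv hnn hR₁ hσ₀ hle hnear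

end Summit.NavierStokesRegularity.NavierStokesRegularity.Theorems.HalfSpaceWindowDoorCirculationCarryingRigidityParabolicConfinement

end
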